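import Mathlib
import Literature.Analysis.Convexity.AnisotropicPerimeterPolytopeFacetFormula
import Literature.Analysis.Convexity.AnisotropicPerimeterComplement
import HarnessLib

/-!
# The facet formula for open H-polytopes of `ℝ³`, chart-free (facet areas as prism volumes)

Topic `Literature/Analysis/Convexity`; namespace `Literature.Analysis.Convexity`.

`AnisotropicPerimeterPolytopeFacetFormula.lean` proves the facet formula
`P_K(P) = Σ_j h_K(a_j)·area_j` (`anisotropicPerimeter_hPolytope_eq_facetSum`) for a compact
H-polytope `P ⊆ (Fin 3 → ℝ)` presented with explicit isometric facet charts
`Φ_j y = p_j + y₁ U_j + y₂ V_j`, the facet areas being read in the charts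
(`area_j = |{y : ℝ × ℝ | Φ_j y ∈ P}|`).  This file removes the charts from the statement:

* `exists_orthonormal_pair_perp` — every vector of `ℝ³` admits an orthonormal pair `U, V ⊥ a`
  (facet frames exist);
* `volume_prism_eq_volume_chartPreimage` — for a set `F` contained in the plane
  `{⟪a, ·⟫ = ⟪a, p⟫}` (`a, U, V` orthonormal), the volume of the unit prism
  `{y + t a : y ∈ F, t ∈ [0, 1]}` equals the chart area `|{y : ℝ × ℝ | p + y₁U + y₂V ∈ F}|`
  (an orthonormal frame is measure preserving) — so "facet area" may be taken to be a prism
  VOLUME, with no Hausdorff-measure normalisation and no chart;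
* `closure_iInter_halfSpace_lt` — the closure of a nonempty open H-polytope
  `⋂_{p ∈ H} {⟪p.1, ·⟫ < p.2}` is the closed H-polytope `⋂_{p ∈ H} {⟪p.1, ·⟫ ≤ p.2}`;
* `anisotropicPerimeter_iInter_halfSpace_lt_eq_facetSum` — **the facet formula for a bounded
  open H-polytope of `EuclideanSpace ℝ (Fin 3)` with unit outer normals and pairwise distinct
  facet planes**, for every compact convex `K ∋ 0`:
  `P_K(⋂_{p∈H} {⟪p.1,·⟫ < p.2}) = Σ_{p ∈ H} h_K(p.1) · |prism over (closure ∩ {⟪p.1,·⟫ = p.2})|`,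
  `h_K(ν) = sup_{y ∈ K} ⟪y, ν⟫` (redundant constraints contribute empty or null facets);
* `volume_chartPreimage_eq_of_frames`, `exists_measurePreserving_chartTransition`,
  `lintegral_comp_chart_eq_of_frames`, `integral_comp_chart_eq_of_frames` — **facet areas and facet
  integrals do not depend on the isometric chart**: the transition map between two orthonormal
  frames of one plane is a measure-preserving measurable equivalence of `ℝ × ℝ` (obtained from the
  prism lemma, without determinants), so `∫ g(p + y₁U + y₂V) dy = ∫ g(p' + y₁U' + y₂V') dy` for every
  integrand (the re-charting needed when two polytopes meet along a common facet plane).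

[cite: Maggi2012, (20.2) p. 258 and Remark 20.3 (the anisotropic surface energy of a set with
polyhedral boundary is the facet sum `Σ_F Φ(ν_F) H^{n-1}(F)`); EvansGariepy2015, Thm 5.16
(Gauss–Green), polyhedral case]
-/

noncomputable section

namespace Literature.Analysis.Convexity

open _root_.MeasureTheory Set Finset Filter
open scoped ENNReal NNReal Topology RealInnerProductSpace
open Literature.MathematicalPhysics.StatisticalMechanics (fieldDivergence)
open Literature.MeasureTheory.Integral

/-! ## Coordinates and frames in `EuclideanSpace ℝ (Fin 3)` -/

/-- `⟪x, y⟫ = Σ_l x_l y_l` on `EuclideanSpace ℝ (Fin 3)`.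
[cite: EvansGariepy2015, Thm 5.16 (Gauss–Green) — plumbing] -/
theorem inner_eq_sum_mul_three (x y : EuclideanSpace ℝ (Fin 3)) : ⟪x, y⟫ = ∑ l, x l * y l := by
  simp [PiLp.inner_apply, mul_comm]

/-- **Facet frames exist**: every `a ∈ ℝ³` admits an orthonormal pair `U, V` orthogonal to `a`.
[cite: EvansGariepy2015, Thm 5.16 (Gauss–Green) — plumbing] -/
theorem exists_orthonormal_pair_perp (a : EuclideanSpace ℝ (Fin 3)) :
    ∃ U V : EuclideanSpace ℝ (Fin 3),
      ‖U‖ = 1 ∧ ‖V‖ = 1 ∧ ⟪U, V⟫ = 0 ∧ ⟪a, U⟫ = 0 ∧ ⟪a, V⟫ = 0 := by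
  by_cases ha : a = 0
  · refine ⟨EuclideanSpace.single 0 1, EuclideanSpace.single 1 1, ?_, ?_, ?_, ?_, ?_⟩ <;>
      simp [ha, PiLp.norm_single, EuclideanSpace.inner_single_left]
  · set S : Submodule ℝ (EuclideanSpace ℝ (Fin 3)) := (ℝ ∙ a)ᗮ with hS
    haveI : Fact (Module.finrank ℝ (EuclideanSpace ℝ (Fin 3)) = 2 + 1) := ⟨by simp⟩
    have h2 : Module.finrank ℝ S = 2 := Submodule.finrank_orthogonal_span_singleton ha
    let c : OrthonormalBasis (Fin 2) ℝ S := (stdOrthonormalBasis ℝ S).reindex (finCongr h2)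
    have hc := c.orthonormal
    rw [orthonormal_iff_ite] at hc
    refine ⟨(c 0 : EuclideanSpace ℝ (Fin 3)), (c 1 : EuclideanSpace ℝ (Fin 3)), ?_, ?_, ?_, ?_, ?_⟩
    · have h := hc 0 0
      simp only [if_true] at h
      rw [Submodule.coe_inner] at h
      have h' : ‖(c 0 : EuclideanSpace ℝ (Fin 3))‖ ^ 2 = 1 := by
        rw [← real_inner_self_eq_norm_sq]; exact h
      nlinarith [norm_nonneg (c 0 : EuclideanSpace ℝ (Fin 3))]
    · have h := hc 1 1
      simp only [if_true] at h
      rw [Submodule.coe_inner] at h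
      have h' : ‖(c 1 : EuclideanSpace ℝ (Fin 3))‖ ^ 2 = 1 := by
        rw [← real_inner_self_eq_norm_sq]; exact h
      nlinarith [norm_nonneg (c 1 : EuclideanSpace ℝ (Fin 3))]
    · have h := hc 0 1
      simp only [zero_ne_one, if_false] at h
      rwa [Submodule.coe_inner] at h
    · exact Submodule.mem_orthogonal_singleton_iff_inner_right.1 (c 0).2
    · exact Submodule.mem_orthogonal_singleton_iff_inner_right.1 (c 1).2

/-! ## Closure of an open H-polytope -/

/-- **The closure of a nonempty open H-polytope is the closed H-polytope**: for a finite family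
of half-spaces, `closure (⋂_{i ∈ s} {⟪a_i, ·⟫ < b_i}) = ⋂_{i ∈ s} {⟪a_i, ·⟫ ≤ b_i}` as soon as the
open polytope is nonempty (segments from an interior point).
[cite: Maggi2012, Exercise 12.10 p. 123 — plumbing] -/
theorem closure_iInter_halfSpace_lt {ι : Type*} (s : Finset ι)
    (a : ι → EuclideanSpace ℝ (Fin 3)) (b : ι → ℝ)
    (hne : (⋂ i ∈ s, {x : EuclideanSpace ℝ (Fin 3) | ⟪a i, x⟫ < b i}).Nonempty) :
    closure (⋂ i ∈ s, {x : EuclideanSpace ℝ (Fin 3) | ⟪a i, x⟫ < b i}) =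
      ⋂ i ∈ s, {x : EuclideanSpace ℝ (Fin 3) | ⟪a i, x⟫ ≤ b i} := by
  apply Set.Subset.antisymm
  · refine closure_minimal ?_ ?_
    · exact Set.iInter₂_mono fun i _ x (hx : ⟪a i, x⟫ < b i) => hx.le
    · exact isClosed_biInter fun i _ => isClosed_le (continuous_const.inner continuous_id)
        continuous_const
  · intro x hx
    obtain ⟨o, ho⟩ := hne
    simp only [Set.mem_iInter, Set.mem_setOf_eq] at hx ho
    -- the segment `o + s (x - o)`, `s → 1⁻`, lies in the open polytope and tends to `x`
    let f : ℝ → EuclideanSpace ℝ (Fin 3) := fun t => o + t • (x - o)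
    have hfc : Continuous f := by fun_prop
    have hft : Tendsto f (𝓝[<] (1 : ℝ)) (𝓝 x) := by
      have h := (hfc.tendsto 1).mono_left (nhdsWithin_le_nhds (s := Set.Iio (1 : ℝ)))
      simpa [f] using h
    refine mem_closure_of_tendsto hft ?_
    filter_upwards [Ioo_mem_nhdsLT zero_lt_one] with t ht
    simp only [Set.mem_iInter, Set.mem_setOf_eq]
    intro i hi
    have h1 : ⟪a i, f t⟫ = (1 - t) * ⟪a i, o⟫ + t * ⟪a i, x⟫ := by
      simp only [f, inner_add_right, inner_smul_right, inner_sub_right]; ring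
    rw [h1]
    have h2 : (1 - t) * ⟪a i, o⟫ < (1 - t) * b i :=
      mul_lt_mul_of_pos_left (ho i hi) (by linarith [ht.2])
    have h3 : t * ⟪a i, x⟫ ≤ t * b i := mul_le_mul_of_nonneg_left (hx i hi) ht.1.le
    linarith

/-! ## Prism volume = chart area -/

/-- An orthonormal triple `U, V, a` of `ℝ³`, as an `Orthonormal` family `![U, V, a]`.
[cite: EvansGariepy2015, Thm 5.16 (Gauss–Green) — plumbing] -/
theorem orthonormal_vec_three {a U V : EuclideanSpace ℝ (Fin 3)} (ha : ‖a‖ = 1) (hU : ‖U‖ = 1)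
    (hV : ‖V‖ = 1) (hUV : ⟪U, V⟫ = 0) (haU : ⟪a, U⟫ = 0) (haV : ⟪a, V⟫ = 0) :
    Orthonormal ℝ ![U, V, a] := by
  rw [orthonormal_iff_ite]
  have hUU : ⟪U, U⟫ = 1 := by rw [real_inner_self_eq_norm_sq, hU, one_pow]
  have hVV : ⟪V, V⟫ = 1 := by rw [real_inner_self_eq_norm_sq, hV, one_pow]
  have haa : ⟪a, a⟫ = 1 := by rw [real_inner_self_eq_norm_sq, ha, one_pow]
  have hVU : ⟪V, U⟫ = 0 := by rw [real_inner_comm]; exact hUV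
  have hUa : ⟪U, a⟫ = 0 := by rw [real_inner_comm]; exact haU
  have hVa : ⟪V, a⟫ = 0 := by rw [real_inner_comm]; exact haV
  intro i j
  fin_cases i <;> fin_cases j <;> simp [hU, hV, ha, hUV, hVU, haU, hUa, haV, hVa]

/-- **Prism volume = chart area.**  Let `U, V, a` be orthonormal in `ℝ³` and let `F` lie in the
plane `{x | ⟪a, x⟫ = ⟪a, p⟫}`.  Then the unit prism `{y + t a : y ∈ F, t ∈ [0,1]}` erected on `F`
has volume equal to the area of `F` read in the isometric chart `y ↦ p + y₁ U + y₂ V`: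
`|{y + t a}| = |{y : ℝ × ℝ | p + y₁U + y₂V ∈ F}|` (no measurability needed: the frame is a
measure-preserving measurable equivalence `ℝ³ ≃ ℝ × ℝ × ℝ`).
[cite: EvansGariepy2015, Thm 5.16 (Gauss–Green) — plumbing; Maggi2012, Remark 20.3 p. 258] -/
theorem volume_prism_eq_volume_chartPreimage {a U V p : EuclideanSpace ℝ (Fin 3)} (ha : ‖a‖ = 1)
    (hU : ‖U‖ = 1) (hV : ‖V‖ = 1) (hUV : ⟪U, V⟫ = 0) (haU : ⟪a, U⟫ = 0) (haV : ⟪a, V⟫ = 0)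
    {F : Set (EuclideanSpace ℝ (Fin 3))} (hF : ∀ y ∈ F, ⟪a, y⟫ = ⟪a, p⟫) :
    volume {x : EuclideanSpace ℝ (Fin 3) | ∃ y ∈ F, ∃ t ∈ Set.Icc (0 : ℝ) 1, x = y + t • a} =
      volume {y : ℝ × ℝ | p + y.1 • U + y.2 • V ∈ F} := by
  classical
  -- the orthonormal basis `b = (U, V, a)`
  have hon := orthonormal_vec_three ha hU hV hUV haU haV
  have hsp : ⊤ ≤ Submodule.span ℝ (Set.range ![U, V, a]) :=
    (hon.linearIndependent.span_eq_top_of_card_eq_finrank (by simp)).ge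
  set b : OrthonormalBasis (Fin 3) ℝ (EuclideanSpace ℝ (Fin 3)) := OrthonormalBasis.mk hon hsp with hb
  have hb0 : b 0 = U := by simp [hb]
  have hb1 : b 1 = V := by simp [hb]
  have hb2 : b 2 = a := by simp [hb]
  have haa : ⟪a, a⟫ = 1 := by rw [real_inner_self_eq_norm_sq, ha, one_pow]
  have hUa : ⟪U, a⟫ = 0 := by rw [real_inner_comm]; exact haU
  have hVa : ⟪V, a⟫ = 0 := by rw [real_inner_comm]; exact haV
  -- expansion in the frame: `z = ⟪U,z⟫ U + ⟪V,z⟫ V + ⟪a,z⟫ a`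
  have hexp : ∀ z : EuclideanSpace ℝ (Fin 3), ⟪U, z⟫ • U + ⟪V, z⟫ • V + ⟪a, z⟫ • a = z := by
    intro z
    have h := b.sum_repr' z
    simp only [Fin.sum_univ_three, hb0, hb1, hb2] at h
    exact h
  -- the measure-preserving equivalences
  let e : EuclideanSpace ℝ (Fin 3) ≃ᵐ (Fin 3 → ℝ) :=
    ((MeasurableEquiv.subRight p).trans b.repr.toHomeomorph.toMeasurableEquiv).trans
      (MeasurableEquiv.toLp 2 (Fin 3 → ℝ)).symm
  have he_apply : ∀ (x : EuclideanSpace ℝ (Fin 3)) (i : Fin 3), e x i = ⟪b i, x - p⟫ := by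
    intro x i
    simp only [e, MeasurableEquiv.coe_trans, Function.comp_apply,
      Homeomorph.toMeasurableEquiv_coe, LinearIsometryEquiv.coe_toHomeomorph,
      MeasurableEquiv.toLp_symm_apply, OrthonormalBasis.repr_apply_apply]
    rfl
  have he : MeasurePreserving e volume volume := by
    have hfun : (⇑e : EuclideanSpace ℝ (Fin 3) → (Fin 3 → ℝ)) =
        (WithLp.ofLp ∘ ⇑b.repr) ∘ fun x => x - p := by
      funext x; rfl
    rw [hfun]
    exact ((PiLp.volume_preserving_ofLp (Fin 3)).comp b.measurePreserving_repr).comp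
      (measurePreserving_sub_right (volume : Measure (EuclideanSpace ℝ (Fin 3))) p)
  let e₂ : (Fin 3 → ℝ) ≃ᵐ ℝ × (Fin 2 → ℝ) := MeasurableEquiv.piFinSuccAbove (fun _ => ℝ) 2
  have he₂ : MeasurePreserving e₂ volume volume := volume_preserving_piFinSuccAbove (fun _ => ℝ) 2
  let e₃ : (Fin 2 → ℝ) ≃ᵐ ℝ × ℝ := MeasurableEquiv.finTwoArrow
  have he₃ : MeasurePreserving e₃ volume volume := volume_preserving_finTwoArrow ℝ
  set S : Set (ℝ × ℝ) := {y : ℝ × ℝ | p + y.1 • U + y.2 • V ∈ F} with hS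
  have h20 : Fin.succAbove (2 : Fin 3) 0 = 0 := by decide
  have h21 : Fin.succAbove (2 : Fin 3) 1 = 1 := by decide
  -- the prism in the frame coordinates is `[0,1] × S`
  have hset : {x : EuclideanSpace ℝ (Fin 3) | ∃ y ∈ F, ∃ t ∈ Set.Icc (0 : ℝ) 1, x = y + t • a} =
      e ⁻¹' (e₂ ⁻¹' (Set.Icc (0 : ℝ) 1 ×ˢ (e₃ ⁻¹' S))) := by
    ext x
    simp only [Set.mem_setOf_eq, Set.mem_preimage, MeasurableEquiv.piFinSuccAbove_apply,
      Fin.insertNthEquiv_symm_apply, Set.mem_prod, MeasurableEquiv.finTwoArrow_apply,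
      Fin.removeNth, h20, h21, he_apply, hb0, hb1, hb2, e₂, e₃, hS]
    constructor
    · rintro ⟨y, hyF, t, ht, rfl⟩
      have hay : ⟪a, y - p⟫ = 0 := by rw [inner_sub_right, hF y hyF, sub_self]
      have h2 : ⟪a, y + t • a - p⟫ = t := by
        rw [show y + t • a - p = (y - p) + t • a by abel, inner_add_right, hay, inner_smul_right,
          haa]; ring
      have hUy : ⟪U, y + t • a - p⟫ = ⟪U, y - p⟫ := by
        rw [show y + t • a - p = (y - p) + t • a by abel, inner_add_right, inner_smul_right, hUa]
        ring
      have hVy : ⟪V, y + t • a - p⟫ = ⟪V, y - p⟫ := by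
        rw [show y + t • a - p = (y - p) + t • a by abel, inner_add_right, inner_smul_right, hVa]
        ring
      refine ⟨by rw [h2]; exact ht, ?_⟩
      rw [hUy, hVy]
      have h := hexp (y - p)
      rw [hay, zero_smul, add_zero] at h
      have : p + ⟪U, y - p⟫ • U + ⟪V, y - p⟫ • V = y := by
        rw [add_assoc, h]; abel
      rw [this]; exact hyF
    · rintro ⟨ht, hyF⟩
      refine ⟨p + ⟪U, x - p⟫ • U + ⟪V, x - p⟫ • V, hyF, ⟪a, x - p⟫, ht, ?_⟩
      have h := hexp (x - p)
      calc x = p + (⟪U, x - p⟫ • U + ⟪V, x - p⟫ • V + ⟪a, x - p⟫ • a) := by rw [h]; abel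
        _ = _ := by abel
  rw [hset, he.measure_preimage_equiv, he₂.measure_preimage_equiv, Measure.volume_eq_prod,
    Measure.prod_prod, Real.volume_Icc, he₃.measure_preimage_equiv]
  simp

/-! ## The chart-free facet formula for open H-polytopes -/

/-- **Facet formula for a bounded open H-polytope of `ℝ³`, chart-free.**  Let
`O = ⋂_{q ∈ H} {x | ⟪q.1, x⟫ < q.2}` be bounded, with unit outer normals `‖q.1‖ = 1` and pairwise
distinct facet planes `{⟪q.1, ·⟫ = q.2}`, and let `K ∋ 0` be compact and convex.  Then
`P_K(O) = Σ_{q ∈ H} h_K(q.1) · |{y + t q.1 : y ∈ closure O ∩ {⟪q.1, ·⟫ = q.2}, t ∈ [0,1]}|`,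
`h_K(ν) = sup_{y ∈ K} ⟪y, ν⟫`: the `K`-perimeter is the sum over the constraints of the support
value of the normal times the facet area, the latter written as the volume of the unit prism
over the facet (empty or null for redundant constraints).  Obtained from the charted formula
`anisotropicPerimeter_hPolytope_eq_facetSum` for the closed polytope (`closure O`, same
`K`-perimeter by convexity) with facet frames from `exists_orthonormal_pair_perp` and
`volume_prism_eq_volume_chartPreimage`.
[cite: Maggi2012, (20.2) p. 258 and Remark 20.3; EvansGariepy2015, Thm 5.16 (Gauss–Green),
polyhedral case] -/
theorem anisotropicPerimeter_iInter_halfSpace_lt_eq_facetSum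
    (H : Finset (EuclideanSpace ℝ (Fin 3) × ℝ))
    (hbdd : Bornology.IsBounded (⋂ q ∈ H, {x : EuclideanSpace ℝ (Fin 3) | ⟪q.1, x⟫ < q.2}))
    (h1 : ∀ q ∈ H, ‖q.1‖ = 1)
    (hd : ∀ q ∈ H, ∀ q' ∈ H, q ≠ q' →
      {x : EuclideanSpace ℝ (Fin 3) | ⟪q.1, x⟫ = q.2} ≠ {x | ⟪q'.1, x⟫ = q'.2})
    {K : Set (EuclideanSpace ℝ (Fin 3))} (hKc : IsCompact K) (hK : Convex ℝ K)
    (hK0 : (0 : EuclideanSpace ℝ (Fin 3)) ∈ K) :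
    anisotropicPerimeter K (⋂ q ∈ H, {x : EuclideanSpace ℝ (Fin 3) | ⟪q.1, x⟫ < q.2}) =
      ENNReal.ofReal (∑ q ∈ H, sSup ((fun y : EuclideanSpace ℝ (Fin 3) => ⟪y, q.1⟫) '' K) *
        (volume {x : EuclideanSpace ℝ (Fin 3) |
          ∃ y ∈ closure (⋂ q ∈ H, {x : EuclideanSpace ℝ (Fin 3) | ⟪q.1, x⟫ < q.2}) ∩
            {x | ⟪q.1, x⟫ = q.2}, ∃ t ∈ Set.Icc (0 : ℝ) 1, x = y + t • q.1}).toReal) := by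
  classical
  set O := ⋂ q ∈ H, {x : EuclideanSpace ℝ (Fin 3) | ⟪q.1, x⟫ < q.2} with hO
  rcases Set.eq_empty_or_nonempty O with hOe | hOne
  · -- both sides vanish
    have h0 : anisotropicPerimeter K O = 0 :=
      anisotropicPerimeter_of_volume_eq_zero (by rw [hOe]; exact measure_empty)
    rw [h0, hOe]
    simp
  -- the closed polytope
  letI : LinearOrder (EuclideanSpace ℝ (Fin 3) × ℝ) := linearOrderOfSTO WellOrderingRel
  set C := ⋂ q ∈ H, {x : EuclideanSpace ℝ (Fin 3) | ⟪q.1, x⟫ ≤ q.2} with hC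
  have hcl : closure O = C := closure_iInter_halfSpace_lt H Prod.fst Prod.snd hOne
  have hOc : Convex ℝ O := convex_iInter₂ fun q _ =>
    convex_halfSpace_lt ⟨fun x y => inner_add_right _ _ _,
      fun c x => by rw [inner_smul_right, smul_eq_mul]⟩ q.2
  have hCc : IsCompact C := hcl ▸ hbdd.isCompact_closure
  -- the data of the charted facet formula
  let a : (EuclideanSpace ℝ (Fin 3) × ℝ) → Fin 3 → ℝ := fun j l => j.1 l
  let b : (EuclideanSpace ℝ (Fin 3) × ℝ) → ℝ := fun j => j.2
  have hfr := fun j : EuclideanSpace ℝ (Fin 3) × ℝ => exists_orthonormal_pair_perp j.1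
  choose U V hU1 hV1 hUV haU haV using hfr
  let pc : (EuclideanSpace ℝ (Fin 3) × ℝ) → Fin 3 → ℝ := fun j l => (j.2 • j.1) l
  let Uc : (EuclideanSpace ℝ (Fin 3) × ℝ) → Fin 3 → ℝ := fun j l => U j l
  let Vc : (EuclideanSpace ℝ (Fin 3) × ℝ) → Fin 3 → ℝ := fun j l => V j l
  set P' : Set (Fin 3 → ℝ) := {x | ∀ j ∈ H, ∑ l, a j l * x l ≤ b j} with hP'
  have hmemP' : ∀ x : Fin 3 → ℝ, x ∈ P' ↔ WithLp.toLp 2 x ∈ C := by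
    intro x
    simp only [hP', hC, Set.mem_setOf_eq, Set.mem_iInter, inner_eq_sum_mul_three, a, b]
  have hCE : {z : EuclideanSpace ℝ (Fin 3) | ∀ j ∈ H, ∑ l, a j l * z l ≤ b j} = C := by
    ext z
    simp only [hC, Set.mem_setOf_eq, Set.mem_iInter, inner_eq_sum_mul_three, a, b]
  have hP'c : IsCompact P' := by
    have hPC : P' = WithLp.ofLp '' C := by
      ext x
      rw [hmemP']
      constructor
      · intro hx; exact ⟨_, hx, rfl⟩
      · rintro ⟨z, hz, rfl⟩; simpa using hz
    rw [hPC]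
    exact hCc.image (PiLp.continuous_ofLp 2 _)
  have hP'ne : P'.Nonempty := by
    obtain ⟨o, ho⟩ := hOne
    refine ⟨WithLp.ofLp o, (hmemP' _).2 ?_⟩
    rw [WithLp.toLp_ofLp, ← hcl]
    exact subset_closure ho
  -- hypotheses of the charted facet formula
  have ha1 : ∀ j ∈ H, ∑ l, a j l ^ 2 = 1 := by
    intro j hj
    have h := EuclideanSpace.real_norm_sq_eq j.1
    rw [h1 j hj, one_pow] at h
    exact h.symm
  have hbd := fun i => filter_sign_nonempty_of_isCompact a b hP'c hP'ne i
  have hnd : ∀ j ∈ H, ∀ k ∈ H, j ≠ k → ¬ ∃ μ : ℝ, (∀ l, a k l = μ * a j l) ∧ b k = μ * b j := by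
    rintro j hj k hk hjk ⟨μ, hμa, hμb⟩
    have hsum : ∑ l, a k l ^ 2 = μ ^ 2 * ∑ l, a j l ^ 2 := by
      rw [Finset.mul_sum]
      exact Finset.sum_congr rfl fun l _ => by rw [hμa l]; ring
    rw [ha1 k hk, ha1 j hj, mul_one] at hsum
    have hμ : μ = 1 ∨ μ = -1 := by
      have h' : (μ - 1) * (μ + 1) = 0 := by nlinarith [hsum]
      rcases mul_eq_zero.1 h' with h' | h'
      · left; linarith
      · right; linarith
    rcases hμ with rfl | rfl
    · apply hjk
      have h1' : k.1 = j.1 := PiLp.ext fun l => by simpa [a] using hμa l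
      have h2' : k.2 = j.2 := by simpa [b] using hμb
      exact (Prod.ext h1' h2').symm
    · apply hd j hj k hk hjk
      ext x
      simp only [Set.mem_setOf_eq, inner_eq_sum_mul_three]
      have hk1 : ∀ l, k.1 l = -j.1 l := fun l => by
        have := hμa l; simp only [a] at this; rw [this]; ring
      have hk2 : k.2 = -j.2 := by have := hμb; simp only [b] at this; rw [this]; ring
      have hs : ∑ l, k.1 l * x l = -∑ l, j.1 l * x l := by
        rw [← Finset.sum_neg_distrib]
        exact Finset.sum_congr rfl fun l _ => by rw [hk1 l]; ring
      rw [hs, hk2, neg_inj]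
  have hpc : ∀ j ∈ H, ∑ l, a j l * pc j l = b j := by
    intro j hj
    have h : ∀ l, pc j l = j.2 * j.1 l := fun l => by simp [pc]
    simp_rw [h]
    calc ∑ l, a j l * (j.2 * j.1 l) = j.2 * ∑ l, a j l ^ 2 := by
          rw [Finset.mul_sum]; exact Finset.sum_congr rfl fun l _ => by simp only [a]; ring
      _ = b j := by rw [ha1 j hj, mul_one]
  have hU : ∀ j ∈ H, ∑ l, a j l * Uc j l = 0 := fun j _ => by
    have h := haU j; rw [inner_eq_sum_mul_three] at h; exact h
  have hV : ∀ j ∈ H, ∑ l, a j l * Vc j l = 0 := fun j _ => by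
    have h := haV j; rw [inner_eq_sum_mul_three] at h; exact h
  have hU1' : ∀ j ∈ H, ∑ l, Uc j l ^ 2 = 1 := fun j _ => by
    have h := EuclideanSpace.real_norm_sq_eq (U j); rw [hU1 j, one_pow] at h; exact h.symm
  have hV1' : ∀ j ∈ H, ∑ l, Vc j l ^ 2 = 1 := fun j _ => by
    have h := EuclideanSpace.real_norm_sq_eq (V j); rw [hV1 j, one_pow] at h; exact h.symm
  have hUV' : ∀ j ∈ H, ∑ l, Uc j l * Vc j l = 0 := fun j _ => by
    have h := hUV j; rw [inner_eq_sum_mul_three] at h; exact h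
  -- per constraint: the support values and the facet areas agree
  have himg : ∀ j ∈ H, (fun k : EuclideanSpace ℝ (Fin 3) => ∑ l, a j l * k l) =
      fun y => ⟪y, j.1⟫ := by
    intro j _
    funext y
    rw [inner_eq_sum_mul_three]
    exact Finset.sum_congr rfl fun l _ => by simp only [a]; ring
  have hvol : ∀ j ∈ H,
      volume {y : ℝ × ℝ | pc j + y.1 • Uc j + y.2 • Vc j ∈
          {x : Fin 3 → ℝ | ∀ j ∈ H, ∑ l, a j l * x l ≤ b j}} =
        volume {x : EuclideanSpace ℝ (Fin 3) | ∃ y ∈ C ∩ {x | ⟪j.1, x⟫ = j.2},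
          ∃ t ∈ Set.Icc (0 : ℝ) 1, x = y + t • j.1} := by
    intro j hj
    have hjj : ⟪j.1, j.1⟫ = 1 := by rw [real_inner_self_eq_norm_sq, h1 j hj, one_pow]
    have hseteq : {y : ℝ × ℝ | pc j + y.1 • Uc j + y.2 • Vc j ∈
          {x : Fin 3 → ℝ | ∀ j ∈ H, ∑ l, a j l * x l ≤ b j}} =
        {y : ℝ × ℝ | j.2 • j.1 + y.1 • U j + y.2 • V j ∈ C ∩ {x | ⟪j.1, x⟫ = j.2}} := by
      ext y
      change (pc j + y.1 • Uc j + y.2 • Vc j ∈ P') ↔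
        (j.2 • j.1 + y.1 • U j + y.2 • V j ∈ C ∩ {x | ⟪j.1, x⟫ = j.2})
      rw [hmemP']
      have ht : WithLp.toLp 2 (pc j + y.1 • Uc j + y.2 • Vc j) =
          j.2 • j.1 + y.1 • U j + y.2 • V j :=
        PiLp.ext fun l => by simp [pc, Uc, Vc]
      rw [ht]
      have hpl : ⟪j.1, j.2 • j.1 + y.1 • U j + y.2 • V j⟫ = j.2 := by
        rw [inner_add_right, inner_add_right, inner_smul_right, inner_smul_right,
          inner_smul_right, haU, haV, hjj]; ring
      simp [hpl]
    rw [hseteq]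
    refine (volume_prism_eq_volume_chartPreimage (h1 j hj) (hU1 j) (hV1 j) (hUV j) (haU j)
      (haV j) (p := j.2 • j.1) (F := C ∩ {x | ⟪j.1, x⟫ = j.2}) ?_).symm
    rintro y ⟨-, hy⟩
    rw [hy, inner_smul_right, hjj, mul_one]
  -- the charted facet formula for the closed polytope, and assembly
  have hmain := anisotropicPerimeter_hPolytope_eq_facetSum (J := H) a b ha1 hbd hnd pc Uc Vc hpc
    hU hV hU1' hV1' hUV' hP'c hKc hK hK0
  rw [hCE] at hmain
  rw [← anisotropicPerimeter_closure_eq_of_convex K hOc, hcl, hmain]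
  congr 1
  exact Finset.sum_congr rfl fun j hj => by rw [himg j hj, hvol j hj]

/-- The facet formula for a bounded open H-polytope of `ℝ³` in `toReal` form (the shape of the
route-side `per K G := (P_K G).toReal`): `(P_K(O)).toReal = Σ_{q ∈ H} h_K(q.1) · |prism over the facet|`
(every summand is `≥ 0` since `0 ∈ K`).
[cite: Maggi2012, (20.2) p. 258 and Remark 20.3; EvansGariepy2015, Thm 5.16 (Gauss–Green),
polyhedral case] -/
theorem toReal_anisotropicPerimeter_iInter_halfSpace_lt_eq_facetSum
    (H : Finset (EuclideanSpace ℝ (Fin 3) × ℝ))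
    (hbdd : Bornology.IsBounded (⋂ q ∈ H, {x : EuclideanSpace ℝ (Fin 3) | ⟪q.1, x⟫ < q.2}))
    (h1 : ∀ q ∈ H, ‖q.1‖ = 1)
    (hd : ∀ q ∈ H, ∀ q' ∈ H, q ≠ q' →
      {x : EuclideanSpace ℝ (Fin 3) | ⟪q.1, x⟫ = q.2} ≠ {x | ⟪q'.1, x⟫ = q'.2})
    {K : Set (EuclideanSpace ℝ (Fin 3))} (hKc : IsCompact K) (hK : Convex ℝ K)
    (hK0 : (0 : EuclideanSpace ℝ (Fin 3)) ∈ K) :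
    (anisotropicPerimeter K (⋂ q ∈ H, {x : EuclideanSpace ℝ (Fin 3) | ⟪q.1, x⟫ < q.2})).toReal =
      ∑ q ∈ H, sSup ((fun y : EuclideanSpace ℝ (Fin 3) => ⟪y, q.1⟫) '' K) *
        (volume {x : EuclideanSpace ℝ (Fin 3) |
          ∃ y ∈ closure (⋂ q ∈ H, {x : EuclideanSpace ℝ (Fin 3) | ⟪q.1, x⟫ < q.2}) ∩
            {x | ⟪q.1, x⟫ = q.2}, ∃ t ∈ Set.Icc (0 : ℝ) 1, x = y + t • q.1}).toReal := by
  rw [anisotropicPerimeter_iInter_halfSpace_lt_eq_facetSum H hbdd h1 hd hKc hK hK0,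
    ENNReal.toReal_ofReal]
  refine Finset.sum_nonneg fun q _ => mul_nonneg ?_ ENNReal.toReal_nonneg
  have hba : BddAbove ((fun y : EuclideanSpace ℝ (Fin 3) => ⟪y, q.1⟫) '' K) :=
    (hKc.image (continuous_id.inner continuous_const)).bddAbove
  have h0 : (0 : ℝ) ∈ (fun y : EuclideanSpace ℝ (Fin 3) => ⟪y, q.1⟫) '' K :=
    ⟨0, hK0, by simp⟩
  exact le_csSup hba h0

/-! ## Chart independence of facet integrals -/

/-- **Expansion in an orthonormal frame of `ℝ³`**: `z = ⟪U, z⟫ U + ⟪V, z⟫ V + ⟪a, z⟫ a`.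
[cite: EvansGariepy2015, Thm 5.16 (Gauss–Green) — plumbing] -/
theorem frame_expansion_three {a U V : EuclideanSpace ℝ (Fin 3)} (ha : ‖a‖ = 1) (hU : ‖U‖ = 1)
    (hV : ‖V‖ = 1) (hUV : ⟪U, V⟫ = 0) (haU : ⟪a, U⟫ = 0) (haV : ⟪a, V⟫ = 0)
    (z : EuclideanSpace ℝ (Fin 3)) : ⟪U, z⟫ • U + ⟪V, z⟫ • V + ⟪a, z⟫ • a = z := by
  have hon := orthonormal_vec_three ha hU hV hUV haU haV
  have hsp : ⊤ ≤ Submodule.span ℝ (Set.range ![U, V, a]) :=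
    (hon.linearIndependent.span_eq_top_of_card_eq_finrank (by simp)).ge
  have h := (OrthonormalBasis.mk hon hsp).sum_repr' z
  simp only [Fin.sum_univ_three, OrthonormalBasis.coe_mk, Matrix.cons_val_zero,
    Matrix.cons_val_one, Matrix.cons_val] at h
  exact h

/-- A point of an isometric facet chart lies in the facet plane: `⟪a, p + y₁U + y₂V⟫ = ⟪a, p⟫`.
[cite: EvansGariepy2015, Thm 5.16 (Gauss–Green) — plumbing] -/
theorem inner_chart_eq {a U V : EuclideanSpace ℝ (Fin 3)} (haU : ⟪a, U⟫ = 0) (haV : ⟪a, V⟫ = 0)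
    (p : EuclideanSpace ℝ (Fin 3)) (y : ℝ × ℝ) : ⟪a, p + y.1 • U + y.2 • V⟫ = ⟪a, p⟫ := by
  rw [inner_add_right, inner_add_right, inner_smul_right, inner_smul_right, haU, haV]; ring

/-- **Chart areas do not depend on the chart.**  For two orthonormal frames `(p, U, V)`, `(p', U', V')`
of the same plane `{⟪a, ·⟫ = ⟪a, p⟫}` and ANY set `A ⊆ ℝ³`:
`|{y | p + y₁U + y₂V ∈ A}| = |{y | p' + y₁U' + y₂V' ∈ A}|` (both are the volume of the unit prism over
`A ∩` plane, `volume_prism_eq_volume_chartPreimage`).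
[cite: EvansGariepy2015, Thm 5.16 (Gauss–Green) — plumbing; Maggi2012, Remark 20.3 p. 258] -/
theorem volume_chartPreimage_eq_of_frames {a U V p U' V' p' : EuclideanSpace ℝ (Fin 3)}
    (ha : ‖a‖ = 1) (hU : ‖U‖ = 1) (hV : ‖V‖ = 1) (hUV : ⟪U, V⟫ = 0) (haU : ⟪a, U⟫ = 0)
    (haV : ⟪a, V⟫ = 0) (hU' : ‖U'‖ = 1) (hV' : ‖V'‖ = 1) (hUV' : ⟪U', V'⟫ = 0) (haU' : ⟪a, U'⟫ = 0)
    (haV' : ⟪a, V'⟫ = 0) (hpp' : ⟪a, p'⟫ = ⟪a, p⟫) (A : Set (EuclideanSpace ℝ (Fin 3))) :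
    volume {y : ℝ × ℝ | p + y.1 • U + y.2 • V ∈ A} =
      volume {y : ℝ × ℝ | p' + y.1 • U' + y.2 • V' ∈ A} := by
  set F : Set (EuclideanSpace ℝ (Fin 3)) := A ∩ {x | ⟪a, x⟫ = ⟪a, p⟫} with hF
  have hFp : ∀ y ∈ F, ⟪a, y⟫ = ⟪a, p⟫ := fun y hy => hy.2
  have hFp' : ∀ y ∈ F, ⟪a, y⟫ = ⟪a, p'⟫ := fun y hy => hpp' ▸ hy.2
  have h1 : {y : ℝ × ℝ | p + y.1 • U + y.2 • V ∈ A} = {y : ℝ × ℝ | p + y.1 • U + y.2 • V ∈ F} := by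
    ext y
    simp only [hF, Set.mem_setOf_eq, Set.mem_inter_iff, inner_chart_eq haU haV, and_true]
  have h2 : {y : ℝ × ℝ | p' + y.1 • U' + y.2 • V' ∈ A} =
      {y : ℝ × ℝ | p' + y.1 • U' + y.2 • V' ∈ F} := by
    ext y
    simp only [hF, Set.mem_setOf_eq, Set.mem_inter_iff, inner_chart_eq haU' haV', hpp', and_true]
  rw [h1, h2, ← volume_prism_eq_volume_chartPreimage ha hU hV hUV haU haV hFp,
    ← volume_prism_eq_volume_chartPreimage ha hU' hV' hUV' haU' haV' hFp']

/-- **The transition map between two isometric charts of a plane is a measure-preserving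
measurable equivalence of `ℝ × ℝ`.**  For two orthonormal frames `(p, U, V)`, `(p', U', V')` of the
plane `{⟪a, ·⟫ = ⟪a, p⟫}` there is `T : ℝ × ℝ ≃ᵐ ℝ × ℝ`, measure preserving, with
`p' + (T y)₁ U' + (T y)₂ V' = p + y₁ U + y₂ V` (it preserves the volume of every set by
`volume_chartPreimage_eq_of_frames`; no determinant is computed).
[cite: EvansGariepy2015, Thm 5.16 (Gauss–Green) — plumbing; Maggi2012, Remark 20.3 p. 258] -/
theorem exists_measurePreserving_chartTransition {a U V p U' V' p' : EuclideanSpace ℝ (Fin 3)}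
    (ha : ‖a‖ = 1) (hU : ‖U‖ = 1) (hV : ‖V‖ = 1) (hUV : ⟪U, V⟫ = 0) (haU : ⟪a, U⟫ = 0)
    (haV : ⟪a, V⟫ = 0) (hU' : ‖U'‖ = 1) (hV' : ‖V'‖ = 1) (hUV' : ⟪U', V'⟫ = 0) (haU' : ⟪a, U'⟫ = 0)
    (haV' : ⟪a, V'⟫ = 0) (hpp' : ⟪a, p'⟫ = ⟪a, p⟫) :
    ∃ T : ℝ × ℝ ≃ᵐ ℝ × ℝ, MeasurePreserving T volume volume ∧
      ∀ y : ℝ × ℝ, p' + (T y).1 • U' + (T y).2 • V' = p + y.1 • U + y.2 • V := by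
  -- the two charts and the transition map
  set Φ : ℝ × ℝ → EuclideanSpace ℝ (Fin 3) := fun y => p + y.1 • U + y.2 • V with hΦ
  set Φ' : ℝ × ℝ → EuclideanSpace ℝ (Fin 3) := fun y => p' + y.1 • U' + y.2 • V' with hΦ'
  have hUU : ⟪U, U⟫ = 1 := by rw [real_inner_self_eq_norm_sq, hU, one_pow]
  have hVV : ⟪V, V⟫ = 1 := by rw [real_inner_self_eq_norm_sq, hV, one_pow]
  have hUU' : ⟪U', U'⟫ = 1 := by rw [real_inner_self_eq_norm_sq, hU', one_pow]
  have hVV' : ⟪V', V'⟫ = 1 := by rw [real_inner_self_eq_norm_sq, hV', one_pow]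
  have hVU : ⟪V, U⟫ = 0 := by rw [real_inner_comm]; exact hUV
  have hVU' : ⟪V', U'⟫ = 0 := by rw [real_inner_comm]; exact hUV'
  -- reading chart coordinates back: `⟪U, Φ y - p⟫ = y₁`, `⟪V, Φ y - p⟫ = y₂`
  have hcoordU : ∀ y : ℝ × ℝ, ⟪U, Φ y - p⟫ = y.1 := fun y => by
    simp only [hΦ, show p + y.1 • U + y.2 • V - p = y.1 • U + y.2 • V by abel, inner_add_right,
      inner_smul_right, hUU, hUV]; ring
  have hcoordV : ∀ y : ℝ × ℝ, ⟪V, Φ y - p⟫ = y.2 := fun y => by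
    simp only [hΦ, show p + y.1 • U + y.2 • V - p = y.1 • U + y.2 • V by abel, inner_add_right,
      inner_smul_right, hVV, hVU]; ring
  have hcoordU' : ∀ y : ℝ × ℝ, ⟪U', Φ' y - p'⟫ = y.1 := fun y => by
    simp only [hΦ', show p' + y.1 • U' + y.2 • V' - p' = y.1 • U' + y.2 • V' by abel,
      inner_add_right, inner_smul_right, hUU', hUV']; ring
  have hcoordV' : ∀ y : ℝ × ℝ, ⟪V', Φ' y - p'⟫ = y.2 := fun y => by
    simp only [hΦ', show p' + y.1 • U' + y.2 • V' - p' = y.1 • U' + y.2 • V' by abel,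
      inner_add_right, inner_smul_right, hVV', hVU']; ring
  -- re-charting a point of the plane: `Φ' (coords' (Φ y)) = Φ y` and conversely
  have hre' : ∀ y : ℝ × ℝ, Φ' (⟪U', Φ y - p'⟫, ⟪V', Φ y - p'⟫) = Φ y := by
    intro y
    have ha0 : ⟪a, Φ y - p'⟫ = 0 := by
      rw [inner_sub_right, hΦ, inner_chart_eq haU haV, hpp', sub_self]
    have h := frame_expansion_three ha hU' hV' hUV' haU' haV' (Φ y - p')
    rw [ha0, zero_smul, add_zero] at h
    show p' + ⟪U', Φ y - p'⟫ • U' + ⟪V', Φ y - p'⟫ • V' = Φ y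
    rw [add_assoc, h]; abel
  have hre : ∀ y : ℝ × ℝ, Φ (⟪U, Φ' y - p⟫, ⟪V, Φ' y - p⟫) = Φ' y := by
    intro y
    have ha0 : ⟪a, Φ' y - p⟫ = 0 := by
      rw [inner_sub_right, hΦ', inner_chart_eq haU' haV', hpp', sub_self]
    have h := frame_expansion_three ha hU hV hUV haU haV (Φ' y - p)
    rw [ha0, zero_smul, add_zero] at h
    show p + ⟪U, Φ' y - p⟫ • U + ⟪V, Φ' y - p⟫ • V = Φ' y
    rw [add_assoc, h]; abel
  have hΦc : Continuous Φ := by rw [hΦ]; fun_prop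
  have hΦ'c : Continuous Φ' := by rw [hΦ']; fun_prop
  let T : ℝ × ℝ ≃ᵐ ℝ × ℝ :=
    { toFun := fun y => (⟪U', Φ y - p'⟫, ⟪V', Φ y - p'⟫)
      invFun := fun y => (⟪U, Φ' y - p⟫, ⟪V, Φ' y - p⟫)
      left_inv := fun y => by
        show (⟪U, Φ' (⟪U', Φ y - p'⟫, ⟪V', Φ y - p'⟫) - p⟫,
          ⟪V, Φ' (⟪U', Φ y - p'⟫, ⟪V', Φ y - p'⟫) - p⟫) = y
        rw [hre' y, hcoordU, hcoordV]
      right_inv := fun y => by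
        show (⟪U', Φ (⟪U, Φ' y - p⟫, ⟪V, Φ' y - p⟫) - p'⟫,
          ⟪V', Φ (⟪U, Φ' y - p⟫, ⟪V, Φ' y - p⟫) - p'⟫) = y
        rw [hre y, hcoordU', hcoordV']
      measurable_toFun := by
        refine Continuous.measurable ?_
        exact ((continuous_const.inner (hΦc.sub continuous_const)).prodMk
          (continuous_const.inner (hΦc.sub continuous_const)))
      measurable_invFun := by
        refine Continuous.measurable ?_
        exact ((continuous_const.inner (hΦ'c.sub continuous_const)).prodMk
          (continuous_const.inner (hΦ'c.sub continuous_const))) }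
  have hT : ∀ y, Φ' (T y) = Φ y := hre'
  -- `Φ'` is injective, so `T ⁻¹' B = {y | Φ y ∈ Φ' '' B}` and `{y | Φ' y ∈ Φ' '' B} = B`
  have hinj : Function.Injective Φ' := by
    intro y₁ y₂ h
    have h1 := hcoordU' y₁; have h2 := hcoordV' y₁
    rw [h, hcoordU'] at h1; rw [h, hcoordV'] at h2
    exact Prod.ext h1.symm h2.symm
  have hpre : ∀ B : Set (ℝ × ℝ), volume (T ⁻¹' B) = volume B := by
    intro B
    have h1 : T ⁻¹' B = {y | Φ y ∈ Φ' '' B} := by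
      ext y
      simp only [Set.mem_preimage, Set.mem_setOf_eq]
      rw [← hT y, hinj.mem_set_image]
    have h2 : {y | Φ' y ∈ Φ' '' B} = B := by
      ext y; simp only [Set.mem_setOf_eq, hinj.mem_set_image]
    rw [h1]
    have h := volume_chartPreimage_eq_of_frames ha hU hV hUV haU haV hU' hV' hUV' haU' haV' hpp'
      (Φ' '' B)
    simp only [hΦ, hΦ'] at h h2 ⊢
    rw [h, h2]
  have hTmp : MeasurePreserving T volume volume := by
    refine ⟨T.measurable, Measure.ext fun B hB => ?_⟩
    rw [Measure.map_apply T.measurable hB, hpre]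
  exact ⟨T, hTmp, fun y => hT y⟩

/-- **Facet integrals do not depend on the chart** (lower Lebesgue integrals, any integrand): for two
orthonormal frames `(p, U, V)`, `(p', U', V')` of the same plane `{⟪a, ·⟫ = ⟪a, p⟫}` and any
`g : ℝ³ → [0, ∞]`, `∫⁻ g(p + y₁U + y₂V) dy = ∫⁻ g(p' + y₁U' + y₂V') dy`.
[cite: EvansGariepy2015, Thm 5.16 (Gauss–Green) — plumbing; Maggi2012, Remark 20.3 p. 258] -/
theorem lintegral_comp_chart_eq_of_frames {a U V p U' V' p' : EuclideanSpace ℝ (Fin 3)}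
    (ha : ‖a‖ = 1) (hU : ‖U‖ = 1) (hV : ‖V‖ = 1) (hUV : ⟪U, V⟫ = 0) (haU : ⟪a, U⟫ = 0)
    (haV : ⟪a, V⟫ = 0) (hU' : ‖U'‖ = 1) (hV' : ‖V'‖ = 1) (hUV' : ⟪U', V'⟫ = 0) (haU' : ⟪a, U'⟫ = 0)
    (haV' : ⟪a, V'⟫ = 0) (hpp' : ⟪a, p'⟫ = ⟪a, p⟫) (g : EuclideanSpace ℝ (Fin 3) → ℝ≥0∞) :
    ∫⁻ y : ℝ × ℝ, g (p + y.1 • U + y.2 • V) = ∫⁻ y : ℝ × ℝ, g (p' + y.1 • U' + y.2 • V') := by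
  obtain ⟨T, hT, hTy⟩ := exists_measurePreserving_chartTransition ha hU hV hUV haU haV hU' hV'
    hUV' haU' haV' hpp'
  have h := hT.lintegral_comp_emb T.measurableEmbedding (fun y => g (p' + y.1 • U' + y.2 • V'))
  simp only [hTy] at h
  exact h

/-- **Facet integrals do not depend on the chart** (Bochner integrals, any integrand, any real normed
target): `∫ g(p + y₁U + y₂V) dy = ∫ g(p' + y₁U' + y₂V') dy` for two orthonormal frames of
the same plane.
[cite: EvansGariepy2015, Thm 5.16 (Gauss–Green) — plumbing; Maggi2012, Remark 20.3 p. 258] -/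
theorem integral_comp_chart_eq_of_frames {F : Type*} [NormedAddCommGroup F] [NormedSpace ℝ F]
    {a U V p U' V' p' : EuclideanSpace ℝ (Fin 3)}
    (ha : ‖a‖ = 1) (hU : ‖U‖ = 1) (hV : ‖V‖ = 1) (hUV : ⟪U, V⟫ = 0) (haU : ⟪a, U⟫ = 0)
    (haV : ⟪a, V⟫ = 0) (hU' : ‖U'‖ = 1) (hV' : ‖V'‖ = 1) (hUV' : ⟪U', V'⟫ = 0) (haU' : ⟪a, U'⟫ = 0)
    (haV' : ⟪a, V'⟫ = 0) (hpp' : ⟪a, p'⟫ = ⟪a, p⟫) (g : EuclideanSpace ℝ (Fin 3) → F) :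
    ∫ y : ℝ × ℝ, g (p + y.1 • U + y.2 • V) = ∫ y : ℝ × ℝ, g (p' + y.1 • U' + y.2 • V') := by
  obtain ⟨T, hT, hTy⟩ := exists_measurePreserving_chartTransition ha hU hV hUV haU haV hU' hV'
    hUV' haU' haV' hpp'
  have h := hT.integral_comp T.measurableEmbedding (fun y => g (p' + y.1 • U' + y.2 • V'))
  simp only [hTy] at h
  exact h

/-- **Facet set-integrals do not depend on the chart**: for two orthonormal frames of the same plane,
`∫_{y | Φ y ∈ A} g(Φ y) dy = ∫_{y | Φ' y ∈ A} g(Φ' y) dy` for every set `A ⊆ ℝ³` and every integrand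
(the form in which facet integrals `∫_{Φ_j y ∈ P} ⟪η(Φ_j y), a_j⟫ dy` occur in the Gauss–Green facet sum).
[cite: EvansGariepy2015, Thm 5.16 (Gauss–Green) — plumbing; Maggi2012, Remark 20.3 p. 258] -/
theorem setIntegral_comp_chart_eq_of_frames {F : Type*} [NormedAddCommGroup F] [NormedSpace ℝ F]
    {a U V p U' V' p' : EuclideanSpace ℝ (Fin 3)}
    (ha : ‖a‖ = 1) (hU : ‖U‖ = 1) (hV : ‖V‖ = 1) (hUV : ⟪U, V⟫ = 0) (haU : ⟪a, U⟫ = 0)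
    (haV : ⟪a, V⟫ = 0) (hU' : ‖U'‖ = 1) (hV' : ‖V'‖ = 1) (hUV' : ⟪U', V'⟫ = 0) (haU' : ⟪a, U'⟫ = 0)
    (haV' : ⟪a, V'⟫ = 0) (hpp' : ⟪a, p'⟫ = ⟪a, p⟫) (A : Set (EuclideanSpace ℝ (Fin 3)))
    (g : EuclideanSpace ℝ (Fin 3) → F) :
    ∫ y in {y : ℝ × ℝ | p + y.1 • U + y.2 • V ∈ A}, g (p + y.1 • U + y.2 • V) =
      ∫ y in {y : ℝ × ℝ | p' + y.1 • U' + y.2 • V' ∈ A}, g (p' + y.1 • U' + y.2 • V') := by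
  obtain ⟨T, hT, hTy⟩ := exists_measurePreserving_chartTransition ha hU hV hUV haU haV hU' hV'
    hUV' haU' haV' hpp'
  have h := hT.setIntegral_preimage_emb T.measurableEmbedding
    (fun y => g (p' + y.1 • U' + y.2 • V')) {y : ℝ × ℝ | p' + y.1 • U' + y.2 • V' ∈ A}
  have hpre : T ⁻¹' {y : ℝ × ℝ | p' + y.1 • U' + y.2 • V' ∈ A} =
      {y : ℝ × ℝ | p + y.1 • U + y.2 • V ∈ A} := by
    ext y; simp only [Set.mem_preimage, Set.mem_setOf_eq, hTy]
  simp only [hTy, hpre] at h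
  exact h

/-- **Facet set-lintegrals do not depend on the chart** (`[0, ∞]`-valued integrands, any set).
[cite: EvansGariepy2015, Thm 5.16 (Gauss–Green) — plumbing; Maggi2012, Remark 20.3 p. 258] -/
theorem setLIntegral_comp_chart_eq_of_frames {a U V p U' V' p' : EuclideanSpace ℝ (Fin 3)}
    (ha : ‖a‖ = 1) (hU : ‖U‖ = 1) (hV : ‖V‖ = 1) (hUV : ⟪U, V⟫ = 0) (haU : ⟪a, U⟫ = 0)
    (haV : ⟪a, V⟫ = 0) (hU' : ‖U'‖ = 1) (hV' : ‖V'‖ = 1) (hUV' : ⟪U', V'⟫ = 0) (haU' : ⟪a, U'⟫ = 0)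
    (haV' : ⟪a, V'⟫ = 0) (hpp' : ⟪a, p'⟫ = ⟪a, p⟫) (A : Set (EuclideanSpace ℝ (Fin 3)))
    (g : EuclideanSpace ℝ (Fin 3) → ℝ≥0∞) :
    ∫⁻ y in {y : ℝ × ℝ | p + y.1 • U + y.2 • V ∈ A}, g (p + y.1 • U + y.2 • V) =
      ∫⁻ y in {y : ℝ × ℝ | p' + y.1 • U' + y.2 • V' ∈ A}, g (p' + y.1 • U' + y.2 • V') := by
  obtain ⟨T, hT, hTy⟩ := exists_measurePreserving_chartTransition ha hU hV hUV haU haV hU' hV'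
    hUV' haU' haV' hpp'
  have h := hT.setLIntegral_comp_preimage_emb T.measurableEmbedding
    (fun y => g (p' + y.1 • U' + y.2 • V')) {y : ℝ × ℝ | p' + y.1 • U' + y.2 • V' ∈ A}
  have hpre : T ⁻¹' {y : ℝ × ℝ | p' + y.1 • U' + y.2 • V' ∈ A} =
      {y : ℝ × ℝ | p + y.1 • U + y.2 • V ∈ A} := by
    ext y; simp only [Set.mem_preimage, Set.mem_setOf_eq, hTy]
  simp only [hTy, hpre] at h
  exact h

/-! ## Coordinate (`Fin 3 → ℝ`, sums) forms of the frame and non-proportionality lemmas -/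

/-- **Facet frames exist, coordinate form** (the shape of the chart hypotheses `hU, hV, hU1, hV1,
hUV` of `anisotropicPerimeter_hPolytope_eq_facetSum`): every `a : Fin 3 → ℝ` admits
`U, V : Fin 3 → ℝ` with `Σ a_l U_l = Σ a_l V_l = 0`, `Σ U_l² = Σ V_l² = 1`, `Σ U_l V_l = 0`.
[cite: EvansGariepy2015, Thm 5.16 (Gauss–Green) — plumbing] -/
theorem exists_frame_sum_three (a : Fin 3 → ℝ) :
    ∃ U V : Fin 3 → ℝ, ∑ l, a l * U l = 0 ∧ ∑ l, a l * V l = 0 ∧ ∑ l, U l ^ 2 = 1 ∧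
      ∑ l, V l ^ 2 = 1 ∧ ∑ l, U l * V l = 0 := by
  obtain ⟨U, V, hU, hV, hUV, haU, haV⟩ := exists_orthonormal_pair_perp (WithLp.toLp 2 a)
  refine ⟨fun l => U l, fun l => V l, ?_, ?_, ?_, ?_, ?_⟩
  · rw [inner_eq_sum_mul_three] at haU; simpa using haU
  · rw [inner_eq_sum_mul_three] at haV; simpa using haV
  · have h := EuclideanSpace.real_norm_sq_eq U; rw [hU, one_pow] at h; exact h.symm
  · have h := EuclideanSpace.real_norm_sq_eq V; rw [hV, one_pow] at h; exact h.symm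
  · rw [inner_eq_sum_mul_three] at hUV; exact hUV

/-- **Distinct facet planes with unit normals are non-proportional constraints** (the shape of the
hypothesis `hnd` of `anisotropicPerimeter_hPolytope_eq_facetSum`, for constraints read from pairs
`q = (ν, c)`): if `‖q.1‖ = ‖q'.1‖ = 1`, `q ≠ q'` and the planes `{⟪q.1, ·⟫ = q.2}`, `{⟪q'.1, ·⟫ = q'.2}`
differ, then `(q'.1, q'.2)` is not a multiple of `(q.1, q.2)`.
[cite: EvansGariepy2015, Thm 5.16 (Gauss–Green) — plumbing] -/
theorem not_proportional_of_planes_ne {q q' : EuclideanSpace ℝ (Fin 3) × ℝ} (h1 : ‖q.1‖ = 1)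
    (h1' : ‖q'.1‖ = 1) (hne : q ≠ q')
    (hd : {x : EuclideanSpace ℝ (Fin 3) | ⟪q.1, x⟫ = q.2} ≠ {x | ⟪q'.1, x⟫ = q'.2}) :
    ¬ ∃ μ : ℝ, (∀ l, q'.1 l = μ * q.1 l) ∧ q'.2 = μ * q.2 := by
  rintro ⟨μ, hμa, hμb⟩
  have ha : ∑ l, q.1 l ^ 2 = 1 := by
    have h := EuclideanSpace.real_norm_sq_eq q.1; rw [h1, one_pow] at h; exact h.symm
  have ha' : ∑ l, q'.1 l ^ 2 = 1 := by
    have h := EuclideanSpace.real_norm_sq_eq q'.1; rw [h1', one_pow] at h; exact h.symm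
  have hsum : ∑ l, q'.1 l ^ 2 = μ ^ 2 * ∑ l, q.1 l ^ 2 := by
    rw [Finset.mul_sum]
    exact Finset.sum_congr rfl fun l _ => by rw [hμa l]; ring
  rw [ha', ha, mul_one] at hsum
  have hμ : μ = 1 ∨ μ = -1 := by
    have h' : (μ - 1) * (μ + 1) = 0 := by nlinarith [hsum]
    rcases mul_eq_zero.1 h' with h' | h'
    · left; linarith
    · right; linarith
  rcases hμ with rfl | rfl
  · apply hne
    have h1'' : q'.1 = q.1 := PiLp.ext fun l => by simpa using hμa l
    have h2'' : q'.2 = q.2 := by simpa using hμb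
    exact (Prod.ext h1'' h2'').symm
  · apply hd
    ext x
    simp only [Set.mem_setOf_eq, inner_eq_sum_mul_three]
    have hk1 : ∀ l, q'.1 l = -q.1 l := fun l => by rw [hμa l]; ring
    have hk2 : q'.2 = -q.2 := by rw [hμb]; ring
    have hs : ∑ l, q'.1 l * x l = -∑ l, q.1 l * x l := by
      rw [← Finset.sum_neg_distrib]
      exact Finset.sum_congr rfl fun l _ => by rw [hk1 l]; ring
    rw [hs, hk2, neg_inj]

end Literature.Analysis.Convexity

end
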